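import Summits.QuantumFields.YangMills.Theorems.FluctuationComparisonRegPrIntLS2BetaTubeLettersSeamTwist
import HarnessLib

/-!
# (RG-K) THE ℤ₂ SEAM TWIST, IV — ALL EIGHT ℤ₂-HOLONOMY SECTORS AND THEIR RESIDUAL-GAUGE ORBITS: TUBE♭ ∕ GAP♭ OUTRIGHT at
# `(V, U₀) = (v • ζ_l^J, (liftTransfTo v) • ζ_l^K)`, `ζ_l := (seam twists of the directions listed in l) 1`, `l : List (Fin 3)` ANY, `v` ANY

Helper for crux `stmt-QuantumFields-20520` (`Theses.UnitScaleTilt.FluctuationComparisonRegPrIntL`), the (T)-chain of LINE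
`semiclassical_s2beta` (cell `ym3-torus`, width seat «width 16» px16 g18).  Sequel of ✓`…S2BetaSeamTwistWords` ∕ ✓`…S2BetaSeamTwistDescent` ∕
✓`…S2BetaTubeLettersSeamTwist` and of ✓`…S2BetaTubeLettersOrbitTransport` (✓p800307).  The multi-direction sector is written INLINE as an
iterated seam twist `l.foldr (fun ν X => fun b => (if b.dir = ν ∧ (b.src ν).val + 1 = N then −1 else 1) * X b) 1` — no definition; for
`l` ranging over the sublists of `[0,1,2]` these are the `2³ = 8` flat `ℤ₂`-connections `ζ_ε` with prescribed holonomies `(−1)^[ν ∈ l]` around the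
three cycles (repetitions in `l` cancel: ✓`seamTwist_seamTwist`).

* §1 (any `GaugeGroup G`, any `Params`) the iterated twist fixes plaquettes and the Wilson action and commutes with `descendTo`
  (`plaqHol_seamFold`, `wilsonAction4_seamFold`, `descendTo_seamFold` — inductions over ✓part II).
* §2 `SU(2)`: `ζ_l^K` is FLAT, lies over `ζ_l^J`, `minActionRegPr … ε₀ ζ_l^J = 0` (✓`regPr_of_flat`, ✓`minActionRegPr_le`∕`_nonneg`).
* §3 ★★★ `exists_tubeGrowth_seamSector` ∕ ★★★ `exists_gapFlat_seamSector`: ✓px12 `exists_tubeGrowth_flat` ∕ `exists_gapFlat_flat` (✓p799103, RECORD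
  17gc) carried from `(1,1)` to EVERY `(v • ζ_l^J, (liftTransfTo v) • ζ_l^K)` — induction on `l` by ✓`tubeGrowthAt_seamTwist_iff` ∕
  ✓`gapFlatAt_seamTwist_iff` (the `hmin` side condition discharged by §2 at both ends), then ✓`tubeGrowthAt_gaugeAct_iff` ∕ ✓`gapFlatAt_gaugeAct_iff`
  at `u := liftTransfTo v` (lit ✓`descTransf_liftTransfTo`).  Same `γ₁`, same `μ` as at `(1,1)`; NO letter; any `L`.

WHAT THIS COVERS: by the ℤ₂ normal form on the discrete torus (lit ✓`TorusChart.eq_d₀_prim_add_seam_wind`; every `±1`-valued gauge `h` lifts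
to the residual group as `liftTransfTo h`), the data `v • ζ_l^J` are ALL gauge transforms of flat `ℤ₂`-connections, i.e. (✓`exists_gauge_
centralValued_of_loopHol_central`) the whole central-holonomy stratum («case B») of `2`-small window data — that identification is NOT typed in
this file (HONEST).  Companion road on the same stratum: ✓px12 `atMostOneCriticalOrbit_of_loopHol_central` (Prop. 7 cl. 1, case B) ∘ px17
`…LiftOfCriticalOrbitUnique` (GAP♭ ⟸ Prop. 7 cl. 1, `L ≥ 5`).

HONEST: composition of landed letters; nothing of Bałaban's analysis; TUBE-REG∘ (K-uniform `μ`, universal `δ`), GAP♯∘, EXW∘, S2β and crux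
20520 stay OPEN; rung R3 (YM₃ on T³) is NOT d = 4, NOT infinite volume, NOT a mass gap, NOT Clay; the Yang–Mills mass gap is NOT proved.
-/

set_option autoImplicit false

noncomputable section

open Set Function
open scoped Matrix.Norms.L2Operator
open Literature.MathematicalPhysics.QuantumFieldTheory.Balaban1983to89
open Literature.MathematicalPhysics.QuantumFieldTheory.Balaban1983to89.T3ContinuumYM3Torus
open Literature.MathematicalPhysics.QuantumFieldTheory.Balaban1983to89.T3UnitLawDensityEML (ℰp)
open Literature.MathematicalPhysics.QuantumFieldTheory.Balaban1983to89.T3UnitScaleTilt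
open Literature.MathematicalPhysics.QuantumFieldTheory.Balaban1983to89.T3TiltDescent
open Literature.MathematicalPhysics.QuantumFieldTheory.Balaban1983to89.T3ConstrainedMinimiser (fibre)
open Literature.MathematicalPhysics.QuantumFieldTheory.Balaban1983to89.T3PrintedRegularMinimiser
open Literature.MathematicalPhysics.QuantumFieldTheory.Balaban1983to89.T3PrintedRegularOrbits
open scoped Literature.MathematicalPhysics.QuantumFieldTheory.Balaban1983to89.T3OrbitAverage
open Literature.MathematicalPhysics.QuantumFieldTheory.Balaban1983to89.ExpMeanLog (deltaSU)
open Summit.QuantumFields.YangMills.Theorems.FluctuationComparisonRegPrIntLS2BetaResidualGaugeCentral (descendTo_one_eml)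
open Summit.QuantumFields.YangMills.Theorems.FluctuationComparisonRegPrIntLRegArgminFlat (regPr_of_flat)
open Summit.QuantumFields.YangMills.Theorems.FluctuationComparisonRegPrIntLS2BetaCriticalOrbitUnique (negOne_mul_comm negOne_mul_negOne)
open Summit.QuantumFields.YangMills.Theorems.BrascampLiebVacuumSC.DimensionGapSU2 (neg_one_mem)
open Summit.QuantumFields.YangMills.Theorems.FluctuationComparisonRegPrIntLS2BetaFlatGapOutright (exists_tubeGrowth_flat exists_gapFlat_flat)
open Summit.QuantumFields.YangMills.Theorems.FluctuationComparisonRegPrIntLS2BetaTubeLettersOrbitTransport (tubeGrowthAt_gaugeAct_iff gapFlatAt_gaugeAct_iff)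
open Summit.QuantumFields.YangMills.Theorems.FluctuationComparisonRegPrIntLS2BetaSeamTwistDescent
open Summit.QuantumFields.YangMills.Theorems.FluctuationComparisonRegPrIntLS2BetaTubeLettersSeamTwist (tubeGrowthAt_seamTwist_iff gapFlatAt_seamTwist_iff)

namespace Summit.QuantumFields.YangMills.Theorems.FluctuationComparisonRegPrIntLS2BetaTubeLettersSeamSectors

/-! ## §1 The iterated seam twist: plaquettes, action, `descendTo` -/

section Generic

variable {P : Params} {j : ℕ} {G : Type*} [GaugeGroup G]

/-- The iterated seam twist fixes every plaquette variable. [cite: Balaban1985Variational, (5)-(6) p.278] -/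
theorem plaqHol_seamFold (n1 : G) (hc : ∀ g : G, n1 * g = g * n1) (U : GaugeField P j G) (p : Plaq P j) :
    ∀ l : List (Fin P.d), GaugeField.plaqHol (l.foldr (fun (ν : Fin P.d) (X : GaugeField P j G) => fun b : PBond P j =>
      (if b.dir = ν ∧ (b.src ν).val + 1 = P.sitesPerDir j then n1 else 1) * X b) U) p = GaugeField.plaqHol U p
  | [] => rfl
  | ν :: l => by
    rw [List.foldr_cons, plaqHol_seamTwist n1 hc ν]
    exact plaqHol_seamFold n1 hc U p l

/-- The iterated seam twist fixes the Wilson action. [cite: Balaban1985Variational, (4) p.278] -/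
theorem wilsonAction4_seamFold (n1 : G) (hc : ∀ g : G, n1 * g = g * n1) (U : GaugeField P j G) (l : List (Fin P.d)) :
    wilsonAction4 (l.foldr (fun (ν : Fin P.d) (X : GaugeField P j G) => fun b : PBond P j =>
      (if b.dir = ν ∧ (b.src ν).val + 1 = P.sitesPerDir j then n1 else 1) * X b) U) = wilsonAction4 U := by
  simp only [wilsonAction4, wilsonAction, plaqHol_seamFold n1 hc U _ l]

end Generic

section Family

variable (F : T3Family) {G : Type*} [GaugeGroup G] (ℰ : LoopAverage G)

/-- ★ **`descendTo` INTERTWINES THE FINE AND THE COARSE ITERATED SEAM TWISTS** (induction over ✓`descendTo_seamTwist`). [cite: Balaban1987RG1, (0.11) p.253] -/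
theorem descendTo_seamFold (n1 : G) (hc : ∀ g : G, n1 * g = g * n1) (hsq : n1 * n1 = 1) {n K : ℕ} (h : n ≤ K)
    (U : GaugeField (F.P K) 0 G) :
    ∀ l : List (Fin 3), descendTo F ℰ n K h (l.foldr (fun (ν : Fin 3) (X : GaugeField (F.P K) 0 G) => fun b : PBond (F.P K) 0 =>
        (if b.dir = ν ∧ (b.src ν).val + 1 = (F.P K).sitesPerDir 0 then n1 else 1) * X b) U) =
      l.foldr (fun (ν : Fin 3) (Y : GaugeField (F.P n) 0 G) => fun c : PBond (F.P n) 0 =>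
        (if c.dir = ν ∧ (c.src ν).val + 1 = (F.P n).sitesPerDir 0 then n1 else 1) * Y c) (descendTo F ℰ n K h U)
  | [] => rfl
  | ν :: l => by
    rw [List.foldr_cons, List.foldr_cons, descendTo_seamTwist F ℰ n1 hc hsq ν h, descendTo_seamFold n1 hc hsq h U l]

end Family

/-! ## §2 `SU(2)`: the sectors `ζ_l` are flat, lie over each other, and have zero regular minimum -/

section SU2

variable (F : T3Family) {J K : ℕ} (hJK : J ≤ K)

/-- `ζ_l^K` is FLAT. [folklore] -/
theorem plaqHol_seamFold_one (l : List (Fin 3)) (p : Plaq (F.P K) 0) :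
    GaugeField.plaqHol (l.foldr (fun (ν : Fin 3) (X : GaugeField (F.P K) 0 (Matrix.specialUnitaryGroup (Fin 2) ℂ)) => fun b : PBond (F.P K) 0 =>
            (if b.dir = ν ∧ (b.src ν).val + 1 = (F.P K).sitesPerDir 0 then (⟨-1, neg_one_mem⟩ : Matrix.specialUnitaryGroup (Fin 2) ℂ) else 1) * X b) (1 : GaugeField (F.P K) 0 (Matrix.specialUnitaryGroup (Fin 2) ℂ))) p = 1 := by
  refine (plaqHol_seamFold (P := F.P K) _ negOne_mul_comm 1 p l).trans ?_
  show (1 : Matrix.specialUnitaryGroup (Fin 2) ℂ) * 1 * 1⁻¹ * 1⁻¹ = 1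
  group

/-- `ζ_l^K` has zero action. [cite: Balaban1985Variational, (4) p.278] -/
theorem wilsonAction4_seamFold_one (l : List (Fin 3)) :
    wilsonAction4 (l.foldr (fun (ν : Fin 3) (X : GaugeField (F.P K) 0 (Matrix.specialUnitaryGroup (Fin 2) ℂ)) => fun b : PBond (F.P K) 0 =>
            (if b.dir = ν ∧ (b.src ν).val + 1 = (F.P K).sitesPerDir 0 then (⟨-1, neg_one_mem⟩ : Matrix.specialUnitaryGroup (Fin 2) ℂ) else 1) * X b) (1 : GaugeField (F.P K) 0 (Matrix.specialUnitaryGroup (Fin 2) ℂ))) = 0 := by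
  exact (wilsonAction4_seamFold (P := F.P K) _ negOne_mul_comm 1 l).trans T3Thm1CarrierNative.wilsonAction4_one_eq_zero

/-- **`ζ_l^K` LIES OVER `ζ_l^J`**: `descendTo ζ_l^K = ζ_l^J`. [cite: Balaban1987RG1, (0.11) p.253] -/
theorem descendTo_seamFold_one (l : List (Fin 3)) :
    descendTo F ℰp J K hJK (l.foldr (fun (ν : Fin 3) (X : GaugeField (F.P K) 0 (Matrix.specialUnitaryGroup (Fin 2) ℂ)) => fun b : PBond (F.P K) 0 =>
            (if b.dir = ν ∧ (b.src ν).val + 1 = (F.P K).sitesPerDir 0 then (⟨-1, neg_one_mem⟩ : Matrix.specialUnitaryGroup (Fin 2) ℂ) else 1) * X b) (1 : GaugeField (F.P K) 0 (Matrix.specialUnitaryGroup (Fin 2) ℂ))) =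
      (l.foldr (fun (ν : Fin 3) (X : GaugeField (F.P J) 0 (Matrix.specialUnitaryGroup (Fin 2) ℂ)) => fun c : PBond (F.P J) 0 =>
            (if c.dir = ν ∧ (c.src ν).val + 1 = (F.P J).sitesPerDir 0 then (⟨-1, neg_one_mem⟩ : Matrix.specialUnitaryGroup (Fin 2) ℂ) else 1) * X c) (1 : GaugeField (F.P J) 0 (Matrix.specialUnitaryGroup (Fin 2) ℂ))) := by
  rw [descendTo_seamFold F ℰp _ negOne_mul_comm negOne_mul_negOne hJK, descendTo_one_eml F hJK]

/-- **THE REGULAR MINIMUM OVER EVERY SECTOR VANISHES** (`ε₀ > 0`). [cite: Balaban1985Variational, (5)-(6) p.278, Thm 1 (8) p.279] -/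
theorem minActionRegPr_seamFold_one {ε₀ : ℝ} (hε₀ : 0 < ε₀) (l : List (Fin 3)) :
    minActionRegPr F J K hJK ε₀ (l.foldr (fun (ν : Fin 3) (X : GaugeField (F.P J) 0 (Matrix.specialUnitaryGroup (Fin 2) ℂ)) => fun c : PBond (F.P J) 0 =>
            (if c.dir = ν ∧ (c.src ν).val + 1 = (F.P J).sitesPerDir 0 then (⟨-1, neg_one_mem⟩ : Matrix.specialUnitaryGroup (Fin 2) ℂ) else 1) * X c) (1 : GaugeField (F.P J) 0 (Matrix.specialUnitaryGroup (Fin 2) ℂ))) = 0 := by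
  have hmem : (l.foldr (fun (ν : Fin 3) (X : GaugeField (F.P K) 0 (Matrix.specialUnitaryGroup (Fin 2) ℂ)) => fun b : PBond (F.P K) 0 =>
            (if b.dir = ν ∧ (b.src ν).val + 1 = (F.P K).sitesPerDir 0 then (⟨-1, neg_one_mem⟩ : Matrix.specialUnitaryGroup (Fin 2) ℂ) else 1) * X b) (1 : GaugeField (F.P K) 0 (Matrix.specialUnitaryGroup (Fin 2) ℂ))) ∈
      regFibrePr F J K hJK ε₀ (l.foldr (fun (ν : Fin 3) (X : GaugeField (F.P J) 0 (Matrix.specialUnitaryGroup (Fin 2) ℂ)) => fun c : PBond (F.P J) 0 =>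
            (if c.dir = ν ∧ (c.src ν).val + 1 = (F.P J).sitesPerDir 0 then (⟨-1, neg_one_mem⟩ : Matrix.specialUnitaryGroup (Fin 2) ℂ) else 1) * X c) (1 : GaugeField (F.P J) 0 (Matrix.specialUnitaryGroup (Fin 2) ℂ))) :=
    (mem_regFibrePr_iff F).2 ⟨descendTo_seamFold_one F hJK l, regPr_of_flat F hε₀ (plaqHol_seamFold_one F l)⟩
  exact le_antisymm ((minActionRegPr_le F hmem).trans_eq (wilsonAction4_seamFold_one F l)) (minActionRegPr_nonneg F _)

end SU2

/-! ## §3 TUBE♭ ∕ GAP♭ OUTRIGHT at every sector and along its residual-gauge orbit -/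

/-- ★★★ **TUBE♭ OUTRIGHT AT `(v • ζ_l^J, (liftTransfTo v) • ζ_l^K)`** for EVERY coarse gauge transformation `v`, EVERY list of twisted directions `l`,
every radius `δ`; the SAME `γ₁(L, b₀, p₀)` and, per `(F, γ, J, K, ε₀, δ)`, the SAME `μ` as ✓px12 `exists_tubeGrowth_flat` at `(1,1)`.  NO letter.
[cite: Balaban1985Variational, (142) p.299, Thm 1 (8) p.279, Sect. G p.305; Balaban1985UV3, (12)-(13) p.259, (18)-(22) p.260] -/
theorem exists_tubeGrowth_seamSector (L : ℕ) (b₀ p₀ : ℝ) (hb : 0 < b₀) (hp : 0 < p₀) :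
    ∃ γ₁ : ℝ, 0 < γ₁ ∧ ∀ (F : T3Family) (γ : ℝ), F.L = L → 0 < γ → γ ≤ γ₁ →
      ∀ (J K : ℕ) (hlt : J < K) (hk : K - J ≤ (F.P K).m + (F.P K).K)
        (ε₀ : ℝ), 0 < ε₀ → (143 * ((((3 + 4 : ℕ) : ℝ)) ^ 2 / 4) ^ 2) * (2 * ε₀) ≤ 1 / 3 →
          2 * (2 * ε₀) ≤ 2 * deltaSU (Fin 2) / (((3 + 4) * F.L : ℕ) : ℝ) ^ 2 →
        ∀ (v : Site (F.P J) 0 → Matrix.specialUnitaryGroup (Fin 2) ℂ) (l : List (Fin 3)) (δ : ℝ),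
          ∃ μ : ℝ, 0 < μ ∧ ∀ U ∈ fibre F ℰp J K hlt.le (GaugeField.gaugeAct v (l.foldr (fun (ν : Fin 3) (X : GaugeField (F.P J) 0 (Matrix.specialUnitaryGroup (Fin 2) ℂ)) => fun c : PBond (F.P J) 0 =>
            (if c.dir = ν ∧ (c.src ν).val + 1 = (F.P J).sitesPerDir 0 then (⟨-1, neg_one_mem⟩ : Matrix.specialUnitaryGroup (Fin 2) ℂ) else 1) * X c) (1 : GaugeField (F.P J) 0 (Matrix.specialUnitaryGroup (Fin 2) ℂ)))),
            U ∈ histGood F ℰp (θBal F.L γ b₀ p₀) K J →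
          (∃ w : Site (F.P K) 0 → Matrix.specialUnitaryGroup (Fin 2) ℂ,
          (∀ U'' : GaugeField (F.P K) 0 (Matrix.specialUnitaryGroup (Fin 2) ℂ),
          descendTo F ℰp J K hlt.le (GaugeField.gaugeAct w U'') = descendTo F ℰp J K hlt.le U'') ∧
          ∀ ℓ : PBond (F.P K) 0, dist1 (U ℓ * ((GaugeField.gaugeAct w
            (GaugeField.gaugeAct (liftTransfTo F J K hlt.le v) (l.foldr (fun (ν : Fin 3) (X : GaugeField (F.P K) 0 (Matrix.specialUnitaryGroup (Fin 2) ℂ)) => fun b : PBond (F.P K) 0 =>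
            (if b.dir = ν ∧ (b.src ν).val + 1 = (F.P K).sitesPerDir 0 then (⟨-1, neg_one_mem⟩ : Matrix.specialUnitaryGroup (Fin 2) ℂ) else 1) * X b) (1 : GaugeField (F.P K) 0 (Matrix.specialUnitaryGroup (Fin 2) ℂ))))) ℓ)⁻¹) ≤ δ) →
          μ * ((F.L : ℝ)⁻¹) ^ (2 * (K - J)) *
          (⨅ w : {w : Site (F.P K) 0 → Matrix.specialUnitaryGroup (Fin 2) ℂ |
          ∀ U : GaugeField (F.P K) 0 (Matrix.specialUnitaryGroup (Fin 2) ℂ),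
          descendTo F ℰp J K hlt.le (GaugeField.gaugeAct w U) = descendTo F ℰp J K hlt.le U},
          ∑ ℓ : PBond (F.P K) 0,
          dist1 (U ℓ * ((GaugeField.gaugeAct (w : Site (F.P K) 0 → Matrix.specialUnitaryGroup (Fin 2) ℂ)
            (GaugeField.gaugeAct (liftTransfTo F J K hlt.le v) (l.foldr (fun (ν : Fin 3) (X : GaugeField (F.P K) 0 (Matrix.specialUnitaryGroup (Fin 2) ℂ)) => fun b : PBond (F.P K) 0 =>
            (if b.dir = ν ∧ (b.src ν).val + 1 = (F.P K).sitesPerDir 0 then (⟨-1, neg_one_mem⟩ : Matrix.specialUnitaryGroup (Fin 2) ℂ) else 1) * X b) (1 : GaugeField (F.P K) 0 (Matrix.specialUnitaryGroup (Fin 2) ℂ))))) ℓ)⁻¹) ^ 2)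
          ≤ wilsonAction4 U - minActionRegPr F J K hlt.le ε₀ (GaugeField.gaugeAct v (l.foldr (fun (ν : Fin 3) (X : GaugeField (F.P J) 0 (Matrix.specialUnitaryGroup (Fin 2) ℂ)) => fun c : PBond (F.P J) 0 =>
            (if c.dir = ν ∧ (c.src ν).val + 1 = (F.P J).sitesPerDir 0 then (⟨-1, neg_one_mem⟩ : Matrix.specialUnitaryGroup (Fin 2) ℂ) else 1) * X c) (1 : GaugeField (F.P J) 0 (Matrix.specialUnitaryGroup (Fin 2) ℂ)))) := by
  obtain ⟨γ₁, hγ₁, hmain⟩ := exists_tubeGrowth_flat L b₀ p₀ hb hp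
  refine ⟨γ₁, hγ₁, ?_⟩
  intro F γ hFL hγ hγle J K hlt hk ε₀ hε₀ hr3 hr2 v l δ
  obtain ⟨μ, hμ, htube⟩ := hmain F γ hFL hγ hγle J K hlt hk ε₀ hε₀ hr3 hr2 δ
  refine ⟨μ, hμ, ?_⟩
  have hsec : ∀ U ∈ fibre F ℰp J K hlt.le (l.foldr (fun (ν : Fin 3) (X : GaugeField (F.P J) 0 (Matrix.specialUnitaryGroup (Fin 2) ℂ)) => fun c : PBond (F.P J) 0 =>
            (if c.dir = ν ∧ (c.src ν).val + 1 = (F.P J).sitesPerDir 0 then (⟨-1, neg_one_mem⟩ : Matrix.specialUnitaryGroup (Fin 2) ℂ) else 1) * X c) (1 : GaugeField (F.P J) 0 (Matrix.specialUnitaryGroup (Fin 2) ℂ))),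
            U ∈ histGood F ℰp (θBal F.L γ b₀ p₀) K J →
          (∃ w : Site (F.P K) 0 → Matrix.specialUnitaryGroup (Fin 2) ℂ,
          (∀ U'' : GaugeField (F.P K) 0 (Matrix.specialUnitaryGroup (Fin 2) ℂ),
          descendTo F ℰp J K hlt.le (GaugeField.gaugeAct w U'') = descendTo F ℰp J K hlt.le U'') ∧
          ∀ ℓ : PBond (F.P K) 0, dist1 (U ℓ * ((GaugeField.gaugeAct w
            (l.foldr (fun (ν : Fin 3) (X : GaugeField (F.P K) 0 (Matrix.specialUnitaryGroup (Fin 2) ℂ)) => fun b : PBond (F.P K) 0 =>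
            (if b.dir = ν ∧ (b.src ν).val + 1 = (F.P K).sitesPerDir 0 then (⟨-1, neg_one_mem⟩ : Matrix.specialUnitaryGroup (Fin 2) ℂ) else 1) * X b) (1 : GaugeField (F.P K) 0 (Matrix.specialUnitaryGroup (Fin 2) ℂ)))) ℓ)⁻¹) ≤ δ) →
          μ * ((F.L : ℝ)⁻¹) ^ (2 * (K - J)) *
          (⨅ w : {w : Site (F.P K) 0 → Matrix.specialUnitaryGroup (Fin 2) ℂ |
          ∀ U : GaugeField (F.P K) 0 (Matrix.specialUnitaryGroup (Fin 2) ℂ),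
          descendTo F ℰp J K hlt.le (GaugeField.gaugeAct w U) = descendTo F ℰp J K hlt.le U},
          ∑ ℓ : PBond (F.P K) 0,
          dist1 (U ℓ * ((GaugeField.gaugeAct (w : Site (F.P K) 0 → Matrix.specialUnitaryGroup (Fin 2) ℂ)
            (l.foldr (fun (ν : Fin 3) (X : GaugeField (F.P K) 0 (Matrix.specialUnitaryGroup (Fin 2) ℂ)) => fun b : PBond (F.P K) 0 =>
            (if b.dir = ν ∧ (b.src ν).val + 1 = (F.P K).sitesPerDir 0 then (⟨-1, neg_one_mem⟩ : Matrix.specialUnitaryGroup (Fin 2) ℂ) else 1) * X b) (1 : GaugeField (F.P K) 0 (Matrix.specialUnitaryGroup (Fin 2) ℂ)))) ℓ)⁻¹) ^ 2)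
          ≤ wilsonAction4 U - minActionRegPr F J K hlt.le ε₀ (l.foldr (fun (ν : Fin 3) (X : GaugeField (F.P J) 0 (Matrix.specialUnitaryGroup (Fin 2) ℂ)) => fun c : PBond (F.P J) 0 =>
            (if c.dir = ν ∧ (c.src ν).val + 1 = (F.P J).sitesPerDir 0 then (⟨-1, neg_one_mem⟩ : Matrix.specialUnitaryGroup (Fin 2) ℂ) else 1) * X c) (1 : GaugeField (F.P J) 0 (Matrix.specialUnitaryGroup (Fin 2) ℂ))) := by
    induction l with
    | nil => exact htube
    | cons ν l ih =>
      rw [List.foldr_cons, List.foldr_cons]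
      exact (tubeGrowthAt_seamTwist_iff F hlt.le _ negOne_mul_comm negOne_mul_negOne ν (γ := γ) (b₀ := b₀) (p₀ := p₀) _ _
        (by rw [minActionRegPr_seamFold_one F hlt.le hε₀ l]; exact minActionRegPr_seamFold_one F hlt.le hε₀ (ν :: l)) δ μ).2 ih
  have h2 := (tubeGrowthAt_gaugeAct_iff F hlt.le (liftTransfTo F J K hlt.le v) (γ := γ) (b₀ := b₀) (p₀ := p₀) hε₀.le _ _ δ μ).2 hsec
  rwa [descTransf_liftTransfTo] at h2

/-- ★★★ **GAP♭ OUTRIGHT AT `(v • ζ_l^J, (liftTransfTo v) • ζ_l^K)`** for EVERY `v`, EVERY `l` (`γ ≤ γ₁(L, b₀, p₀, δ)`, same `γ₁`, same `μ` as ✓px12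
`exists_gapFlat_flat` at `(1,1)`).  NO letter. [cite: Balaban1985Variational, (142) p.299, Thm 1 (8) p.279; Balaban1984PropagatorsII, (1.33); Balaban1985UV3, (12)-(13) p.259] -/
theorem exists_gapFlat_seamSector (L : ℕ) (b₀ p₀ : ℝ) (hb : 0 < b₀) (hp : 0 < p₀) (δ : ℝ) (hδ : 0 < δ) :
    ∃ γ₁ : ℝ, 0 < γ₁ ∧ ∀ (F : T3Family) (γ : ℝ), F.L = L → 0 < γ → γ ≤ γ₁ →
      ∀ (J K : ℕ) (hlt : J < K) (hk : K - J ≤ (F.P K).m + (F.P K).K)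
        (ε₀ : ℝ), 0 < ε₀ → (143 * ((((3 + 4 : ℕ) : ℝ)) ^ 2 / 4) ^ 2) * (2 * ε₀) ≤ 1 / 3 →
          2 * (2 * ε₀) ≤ 2 * deltaSU (Fin 2) / (((3 + 4) * F.L : ℕ) : ℝ) ^ 2 →
        ∀ (v : Site (F.P J) 0 → Matrix.specialUnitaryGroup (Fin 2) ℂ) (l : List (Fin 3)),
        ∃ μ : ℝ, 0 < μ ∧ ∀ U ∈ fibre F ℰp J K hlt.le (GaugeField.gaugeAct v (l.foldr (fun (ν : Fin 3) (X : GaugeField (F.P J) 0 (Matrix.specialUnitaryGroup (Fin 2) ℂ)) => fun c : PBond (F.P J) 0 =>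
            (if c.dir = ν ∧ (c.src ν).val + 1 = (F.P J).sitesPerDir 0 then (⟨-1, neg_one_mem⟩ : Matrix.specialUnitaryGroup (Fin 2) ℂ) else 1) * X c) (1 : GaugeField (F.P J) 0 (Matrix.specialUnitaryGroup (Fin 2) ℂ)))),
          U ∈ histGood F ℰp (θBal F.L γ b₀ p₀) K J →
        μ * ((F.L : ℝ)⁻¹) ^ (2 * (K - J)) *
        (⨅ w : {w : Site (F.P K) 0 → Matrix.specialUnitaryGroup (Fin 2) ℂ |
        ∀ U : GaugeField (F.P K) 0 (Matrix.specialUnitaryGroup (Fin 2) ℂ),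
        descendTo F ℰp J K hlt.le (GaugeField.gaugeAct w U) = descendTo F ℰp J K hlt.le U},
        ∑ ℓ : PBond (F.P K) 0,
        dist1 (U ℓ * ((GaugeField.gaugeAct (w : Site (F.P K) 0 → Matrix.specialUnitaryGroup (Fin 2) ℂ)
          (GaugeField.gaugeAct (liftTransfTo F J K hlt.le v) (l.foldr (fun (ν : Fin 3) (X : GaugeField (F.P K) 0 (Matrix.specialUnitaryGroup (Fin 2) ℂ)) => fun b : PBond (F.P K) 0 =>
            (if b.dir = ν ∧ (b.src ν).val + 1 = (F.P K).sitesPerDir 0 then (⟨-1, neg_one_mem⟩ : Matrix.specialUnitaryGroup (Fin 2) ℂ) else 1) * X b) (1 : GaugeField (F.P K) 0 (Matrix.specialUnitaryGroup (Fin 2) ℂ))))) ℓ)⁻¹) ^ 2)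
        ≤ wilsonAction4 U - minActionRegPr F J K hlt.le ε₀ (GaugeField.gaugeAct v (l.foldr (fun (ν : Fin 3) (X : GaugeField (F.P J) 0 (Matrix.specialUnitaryGroup (Fin 2) ℂ)) => fun c : PBond (F.P J) 0 =>
            (if c.dir = ν ∧ (c.src ν).val + 1 = (F.P J).sitesPerDir 0 then (⟨-1, neg_one_mem⟩ : Matrix.specialUnitaryGroup (Fin 2) ℂ) else 1) * X c) (1 : GaugeField (F.P J) 0 (Matrix.specialUnitaryGroup (Fin 2) ℂ)))) := by
  obtain ⟨γ₁, hγ₁, hmain⟩ := exists_gapFlat_flat L b₀ p₀ hb hp δ hδ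
  refine ⟨γ₁, hγ₁, ?_⟩
  intro F γ hFL hγ hγle J K hlt hk ε₀ hε₀ hr3 hr2 v l
  obtain ⟨μ, hμ, hgap⟩ := hmain F γ hFL hγ hγle J K hlt hk ε₀ hε₀ hr3 hr2
  refine ⟨μ, hμ, ?_⟩
  have hsec : ∀ U ∈ fibre F ℰp J K hlt.le (l.foldr (fun (ν : Fin 3) (X : GaugeField (F.P J) 0 (Matrix.specialUnitaryGroup (Fin 2) ℂ)) => fun c : PBond (F.P J) 0 =>
            (if c.dir = ν ∧ (c.src ν).val + 1 = (F.P J).sitesPerDir 0 then (⟨-1, neg_one_mem⟩ : Matrix.specialUnitaryGroup (Fin 2) ℂ) else 1) * X c) (1 : GaugeField (F.P J) 0 (Matrix.specialUnitaryGroup (Fin 2) ℂ))),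
          U ∈ histGood F ℰp (θBal F.L γ b₀ p₀) K J →
        μ * ((F.L : ℝ)⁻¹) ^ (2 * (K - J)) *
        (⨅ w : {w : Site (F.P K) 0 → Matrix.specialUnitaryGroup (Fin 2) ℂ |
        ∀ U : GaugeField (F.P K) 0 (Matrix.specialUnitaryGroup (Fin 2) ℂ),
        descendTo F ℰp J K hlt.le (GaugeField.gaugeAct w U) = descendTo F ℰp J K hlt.le U},
        ∑ ℓ : PBond (F.P K) 0,
        dist1 (U ℓ * ((GaugeField.gaugeAct (w : Site (F.P K) 0 → Matrix.specialUnitaryGroup (Fin 2) ℂ)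
          (l.foldr (fun (ν : Fin 3) (X : GaugeField (F.P K) 0 (Matrix.specialUnitaryGroup (Fin 2) ℂ)) => fun b : PBond (F.P K) 0 =>
            (if b.dir = ν ∧ (b.src ν).val + 1 = (F.P K).sitesPerDir 0 then (⟨-1, neg_one_mem⟩ : Matrix.specialUnitaryGroup (Fin 2) ℂ) else 1) * X b) (1 : GaugeField (F.P K) 0 (Matrix.specialUnitaryGroup (Fin 2) ℂ)))) ℓ)⁻¹) ^ 2)
        ≤ wilsonAction4 U - minActionRegPr F J K hlt.le ε₀ (l.foldr (fun (ν : Fin 3) (X : GaugeField (F.P J) 0 (Matrix.specialUnitaryGroup (Fin 2) ℂ)) => fun c : PBond (F.P J) 0 =>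
            (if c.dir = ν ∧ (c.src ν).val + 1 = (F.P J).sitesPerDir 0 then (⟨-1, neg_one_mem⟩ : Matrix.specialUnitaryGroup (Fin 2) ℂ) else 1) * X c) (1 : GaugeField (F.P J) 0 (Matrix.specialUnitaryGroup (Fin 2) ℂ))) := by
    induction l with
    | nil => exact hgap
    | cons ν l ih =>
      rw [List.foldr_cons, List.foldr_cons]
      exact (gapFlatAt_seamTwist_iff F hlt.le _ negOne_mul_comm negOne_mul_negOne ν (γ := γ) (b₀ := b₀) (p₀ := p₀) _ _
        (by rw [minActionRegPr_seamFold_one F hlt.le hε₀ l]; exact minActionRegPr_seamFold_one F hlt.le hε₀ (ν :: l)) μ).2 ih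
  have h2 := (gapFlatAt_gaugeAct_iff F hlt.le (liftTransfTo F J K hlt.le v) (γ := γ) (b₀ := b₀) (p₀ := p₀) hε₀.le _ _ μ).2 hsec
  rwa [descTransf_liftTransfTo] at h2

end Summit.QuantumFields.YangMills.Theorems.FluctuationComparisonRegPrIntLS2BetaTubeLettersSeamSectors

end
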